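import Summits.NavierStokesRegularity.NavierStokesRegularity.Theses.PalasekTowerBreakdown
import Summits.NavierStokesRegularity.FluidComputer.PalasekTowerRegisterGlobalStrainCeiling

/-!
# NavierStokesRegularity — route `PalasekTowerBreakdown`: the child crux `HeredityFromTwo` and its
# halves read through the STRAIN CEILING of the quiet window (KNSS 2009 (4.6), discharged in the tree)

Supports `stmt-NavierStokesRegularity-19250` (`PalasekTowerBreakdown.HeredityFromTwo := HeredityFrom 2`;
registered skeleton v2 of seat `ns-palasek-19250-p1`: stubs `stub_apriori_ceiling : AprioriCeiling` /
`stub_readout_floors : ReadoutFloors`; v1 `Cruxes/HeredityFromTwo/Lines/birth.lean`: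
`stub_continuation_envelope : ContinuationEnvelope ↔ AprioriCeiling`). Cell `ns-blowup`, seat
`ns-blowup-ecbridge-5` (g5; bridge support — nothing claimed). LABEL: E–C typing + kernel analysis
(glue over `FluidComputer/PalasekTowerRegisterGlobalStrainCeiling.lean`, this seat: KNSS 2009 Prop. 4.1 /
(4.6) — `‖∇u‖ ≤ C·M²` past the first `ε/M²` of a silent window on which `‖u‖ ≤ M`, `ε, C` UNIVERSAL —
for every finite-energy classical continuation of a registered stage; under RIGIDITY the growth window
is eventually long in the next ceiling's units, `(c₂Y_{k+1})²(τ_{k+1} − τ_k) → ∞`, so from some level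
`k₀` on — `k₀` depending on the rates and on KNSS's non-explicit `ε`, NOT on the design — no window
hypothesis is needed). WHAT THIS IS NOT: not Navier–Stokes evidence — no stage, flow or tower is
constructed or claimed; nothing below proves or refutes `AprioriCeiling`, `ReadoutFloors` or the crux;
the theorems are NECESSARY readout numbers every late hand-over carries (strain side), twins of the
circulation band of `PalasekTowerBreakdownHeredityFromTwoCoreFloors.lean` (p431318).

* `palasekTowerBreakdown_stage_strainCeiling` — UNCONDITIONAL: a level `k₀` and a universal `C ≥ 0`
  such that every globally anchored registered stage at a level `k + 1`, `k ≥ max 1 k₀`, of a pinned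
  rigid quiet schedule on the wide rates has `‖∇u(τ_{k+1}, x)‖ ≤ C (c₂ Y_{k+1})²` EVERYWHERE, next to
  its registered strain floor `c₁ A_{k+1} ≤ ‖∇u(τ_{k+1}, x_{k+1})‖` somewhere in the ball — so such a
  stage, IF IT EXISTS, certifies `N_{k+1}^{23/10} ≤ C (25/9) N_{k+1}^{13/5}`
  (`…_stage_strain_floor_le_ceiling`);
* `palasekTowerBreakdown_aprioriCeiling_strainCeiling` — under the UPPER stub `AprioriCeiling`, every
  finite-energy classical continuation of a late registered stage to `[0, τ_{k+1}]` (the objects the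
  LOWER stub `ReadoutFloors` quantifies over) has `‖∇u(τ_{k+1}, x)‖ ≤ C (c₂ Y_{k+1})²` everywhere;
* `palasekTowerBreakdown_heredityFromTwo_extension_strainCeiling` — under the child crux (route decl BY
  NAME) every late extension stage is so capped; `…_heredityFromTwo_strain_floor_le_ceiling` — and the
  floor-under-ceiling inequality holds on every schedule carrying a late stage.

Reading: the register asks the level-`(k+1)` readout to show strain `≥ A_{k+1}` while parabolic
smoothing caps EVERY continuation at `C (c₂ Y_{k+1})² = C (25/9) N_{k+1}^{3/10}·A_{k+1}` — the floor sits
a level-Reynolds factor `≍ N_{k+1}^{0.3}` (`≈ 7.5` at `k = 1`, `≈ 9.2` at `k = 2`, unbounded) below the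
universal ceiling, uniformly in the design; consistent, and tight only up to KNSS's constant.

References: G. Koch, N. Nadirashvili, G. Seregin, V. Šverák, Acta Math. 203 (2009), Prop. 4.1 with (4.6)
[cite: KochNadirashviliSereginSverak2009, Prop. 4.1 (4.6)]; S. Palasek, arXiv:2605.13827 §4
[cite: Palasek2026ElementaryModel, §4].
-/

-- `Summit.<Summit>.<Problem>` is the tree's mandated summit-side namespace (CONVENTIONS §2); for this
-- single-conjunct summit the two coincide, so the duplicate is deliberate.
set_option linter.dupNamespace false

noncomputable section

namespace Summit.NavierStokesRegularity.NavierStokesRegularity.Theorems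

open Set MeasureTheory Real Filter
open scoped ENNReal
open Summit.NavierStokesRegularity.NavierStokesRegularity.Theses
open Summit.NavierStokesRegularity.FluidComputer.PalasekTowerClayBridge
open Literature.Analysis.FluidPDE

/-! ## §1 Unconditional: every late registered stage is strain-capped at its top readout -/

/-- **Every late registered stage is strain-capped at its top readout (unconditional).** There are a
level `k₀` and a universal `C ≥ 0` such that every globally anchored registered stage `s` at level
`k + 1`, `k ≥ max 1 k₀`, of a pinned (`Λ = 8`, `θ = 6/5`), rigid, quiet schedule on the wide-base rates
satisfies `‖∇s.u(τ_{k+1}, x)‖ ≤ C (c₂ Y_{k+1})²` for every `x` (the force is silent on `[τ_1, τ_{k+1}]`,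
the speed is `≤ c₂ Y_{k+1}` throughout, and the window `τ_{k+1} − τ_k` alone is already `≥ ε/(c₂Y_{k+1})²`
long for `k ≥ k₀`). Nothing here says such a stage exists. [cite: KochNadirashviliSereginSverak2009, Prop. 4.1 with (4.6), k = 1 (arXiv:0709.3599v1 p. 8)] -/
theorem palasekTowerBreakdown_stage_strainCeiling :
    ∃ k₀ : ℕ, ∃ C : ℝ, 0 ≤ C ∧
      ∀ {S : Schedule TowerRates.wide} {k : ℕ}, S.Pins 8 (6 / 5) → S.Rigid → S.Quiet → 1 ≤ k →
        k₀ ≤ k → ∀ (s : Stage 1 TowerRates.wide S (Margins.routeG TowerRates.wide) (k + 1))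
          (x : EuclideanSpace ℝ (Fin 3)),
          ‖fderiv ℝ (s.u (S.τ (k + 1))) x‖ ≤ C * (S.c₂ * TowerRates.wide.Y (k + 1)) ^ 2 := by
  obtain ⟨k₀, C, hC, H⟩ := Stage.exists_level_strainCeiling_top TowerRates.wide
  exact ⟨k₀, C, hC, fun _ hRig hQ hk hk' s x => H hRig hQ hk hk' s x⟩

/-- **Floor under ceiling (unconditional).** With the same `k₀, C`: a pinned rigid quiet schedule on
the wide rates that CARRIES a globally anchored registered stage at a level `k + 1`, `k ≥ max 1 k₀`,
satisfies `c₁ A_{k+1} ≤ C (c₂ Y_{k+1})²` — the stage's registered strain floor at `τ_{k+1}` read against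
the universal strain ceiling; with the rigid constants, `N_{k+1}^{23/10} ≤ C (25/9) N_{k+1}^{13/5}`. A
necessary condition every late rung certifies; vacuous while no stage is exhibited. [folklore] -/
theorem palasekTowerBreakdown_stage_strain_floor_le_ceiling :
    ∃ k₀ : ℕ, ∃ C : ℝ, 0 ≤ C ∧
      ∀ {S : Schedule TowerRates.wide} {k : ℕ}, S.Pins 8 (6 / 5) → S.Rigid → S.Quiet → 1 ≤ k →
        k₀ ≤ k → Nonempty (Stage 1 TowerRates.wide S (Margins.routeG TowerRates.wide) (k + 1)) →
          S.c₁ * TowerRates.wide.A (k + 1) ≤ C * (S.c₂ * TowerRates.wide.Y (k + 1)) ^ 2 := by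
  obtain ⟨k₀, C, hC, H⟩ := Stage.exists_level_strain_floor_le_ceiling TowerRates.wide
  exact ⟨k₀, C, hC, fun _ hRig hQ hk hk' ⟨s⟩ => H hRig hQ hk hk' s⟩

/-! ## §2 The halves and the child crux by name -/

/-- **Under the UPPER stub `AprioriCeiling` every late continuation is strain-capped at the next
readout.** There are a level `k₀` and a universal `C ≥ 0` such that, if `AprioriCeiling` holds, then for
every pinned rigid quiet schedule on the wide rates, every level `k ≥ max 2 k₀`, every registered stage
`s` at level `k` and EVERY classical finite-energy continuation `(u, p)` of `s` to `[0, τ_{k+1}]` (the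
objects the LOWER stub `ReadoutFloors` quantifies over — their ceiling hypothesis is what `AprioriCeiling`
supplies), `‖∇u(τ_{k+1}, x)‖ ≤ C (c₂ Y_{k+1})²` for every `x`. So under the upper stub the lower stub's
strain conjunct asks for a point where the gradient lies in `[c₁ A_{k+1}, C (c₂ Y_{k+1})²]`. [folklore] -/
theorem palasekTowerBreakdown_aprioriCeiling_strainCeiling :
    ∃ k₀ : ℕ, ∃ C : ℝ, 0 ≤ C ∧ (AprioriCeiling →
      ∀ {S : Schedule TowerRates.wide} {k : ℕ}, S.Pins 8 (6 / 5) → S.Rigid → S.Quiet → 2 ≤ k →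
        k₀ ≤ k → ∀ (s : Stage 1 TowerRates.wide S (Margins.routeG TowerRates.wide) k)
          {u : ℝ → EuclideanSpace ℝ (Fin 3) → EuclideanSpace ℝ (Fin 3)}
          {p : ℝ → EuclideanSpace ℝ (Fin 3) → ℝ},
          IsClassicalNSSolutionOn (Icc 0 (S.τ (k + 1))) 1 S.f u p →
          (∀ t ∈ Icc 0 (S.τ k), u t = s.u t ∧ p t = s.p t) →
          (∃ E : ℝ≥0∞, E < ⊤ ∧ ∀ t ∈ Icc 0 (S.τ (k + 1)), ∫⁻ x, ‖u t x‖ₑ ^ 2 ≤ E) →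
          ∀ x, ‖fderiv ℝ (u (S.τ (k + 1))) x‖ ≤ C * (S.c₂ * TowerRates.wide.Y (k + 1)) ^ 2) := by
  obtain ⟨k₀, C, hC, H⟩ := exists_level_strainCeiling_readout TowerRates.wide
  refine ⟨k₀, C, hC, fun h S k hP hRig hQ hk hk' s u p hcl hagree hE x => ?_⟩
  have hceil := h S hP hRig hQ k hk s (S.τ (k + 1)) ⟨(S.τ_lt_succ k).le, le_rfl⟩ u p hcl hagree hE
  exact H hRig hQ (by omega) hk' s hcl (fun t ht => (hagree t ht).1) hE hceil x

/-- **Under the child crux every late extension is strain-capped at its readout** (route decl BY NAME).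
There are a level `k₀` and a universal `C ≥ 0` such that, if `PalasekTowerBreakdown.HeredityFromTwo`
holds, then for every pinned rigid quiet schedule on the wide rates, every `k ≥ max 2 k₀` and every
globally anchored registered stage `s` at level `k`, the extension stage `s'` (unique in velocity,
`Stage.continuation_velocity_eq`) has `‖∇s'.u(τ_{k+1}, x)‖ ≤ C (c₂ Y_{k+1})²` for all `x`, next to its
registered strain floor `c₁ A_{k+1} ≤ ‖∇s'.u(τ_{k+1}, x_{k+1})‖` in the ball. [folklore] -/
theorem palasekTowerBreakdown_heredityFromTwo_extension_strainCeiling :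
    ∃ k₀ : ℕ, ∃ C : ℝ, 0 ≤ C ∧ (PalasekTowerBreakdown.HeredityFromTwo →
      ∀ {S : Schedule TowerRates.wide} {k : ℕ}, S.Pins 8 (6 / 5) → S.Rigid → S.Quiet → 2 ≤ k →
        k₀ ≤ k → ∀ (s : Stage 1 TowerRates.wide S (Margins.routeG TowerRates.wide) k),
          ∃ s' : Stage 1 TowerRates.wide S (Margins.routeG TowerRates.wide) (k + 1), s.Extends s' ∧
            (∃ x, ‖x‖ ≤ S.radius ∧
              S.c₁ * TowerRates.wide.A (k + 1) ≤ ‖fderiv ℝ (s'.u (S.τ (k + 1))) x‖) ∧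
            ∀ x, ‖fderiv ℝ (s'.u (S.τ (k + 1))) x‖ ≤ C * (S.c₂ * TowerRates.wide.Y (k + 1)) ^ 2) := by
  obtain ⟨k₀, C, hC, H⟩ := Stage.exists_level_strainCeiling_top TowerRates.wide
  refine ⟨k₀, C, hC, fun h S k hP hRig hQ hk hk' s => ?_⟩
  obtain ⟨s', hs'⟩ := h S hP hRig hQ k hk s
  exact ⟨s', hs', s'.strain (k + 1) le_rfl, fun x => H hRig hQ (by omega) hk' s' x⟩

/-- **The child crux certifies the floor-under-ceiling inequality at every late level that carries a
stage**: with the same `k₀, C`, if `PalasekTowerBreakdown.HeredityFromTwo` holds then every pinned rigid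
quiet schedule on the wide rates carrying a globally anchored registered stage at a level `k ≥ max 2 k₀`
satisfies `c₁ A_{k+1} ≤ C (c₂ Y_{k+1})²`, i.e. `N_{k+1}^{23/10} ≤ C (25/9) N_{k+1}^{13/5}` with the rigid
constants. (Equally a consequence of `palasekTowerBreakdown_stage_strain_floor_le_ceiling` and the
extension; recorded by name for the item.) [folklore] -/
theorem palasekTowerBreakdown_heredityFromTwo_strain_floor_le_ceiling :
    ∃ k₀ : ℕ, ∃ C : ℝ, 0 ≤ C ∧ (PalasekTowerBreakdown.HeredityFromTwo →
      ∀ {S : Schedule TowerRates.wide} {k : ℕ}, S.Pins 8 (6 / 5) → S.Rigid → S.Quiet → 2 ≤ k →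
        k₀ ≤ k → Nonempty (Stage 1 TowerRates.wide S (Margins.routeG TowerRates.wide) k) →
          S.c₁ * TowerRates.wide.A (k + 1) ≤ C * (S.c₂ * TowerRates.wide.Y (k + 1)) ^ 2) := by
  obtain ⟨k₀, C, hC, H⟩ := Stage.exists_level_strain_floor_le_ceiling TowerRates.wide
  refine ⟨k₀, C, hC, fun h S k hP hRig hQ hk hk' ⟨s⟩ => ?_⟩
  obtain ⟨s', -⟩ := h S hP hRig hQ k hk s
  exact H hRig hQ (by omega) hk' s'

/-- **The rigid-constant reading of the floor-under-ceiling inequality** (pure rate algebra): on a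
rigid schedule (`c₁ = 1`, `c₂ = 5/3`) the inequality `c₁ A_j ≤ C (c₂ Y_j)²` says
`N_j^β ≤ C · (25/9) · N_j^{2(β-1)}`, i.e. `1 ≤ C · (25/9) · N_j^{β-2}` — on the wide rates
`(9/25) N_j^{-3/10} ≤ C`. [folklore] -/
theorem palasekTowerBreakdown_strain_floor_le_ceiling_iff {S : Schedule TowerRates.wide} (hR : S.Rigid)
    {C : ℝ} (j : ℕ) :
    S.c₁ * TowerRates.wide.A j ≤ C * (S.c₂ * TowerRates.wide.Y j) ^ 2 ↔
      1 ≤ C * (25 / 9) * TowerRates.wide.N j ^ (TowerRates.wide.β - 2) := by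
  have hN := TowerRates.wide.N_pos j
  have hA : 0 < TowerRates.wide.A j := TowerRates.wide.A_pos j
  have hY2 : (S.c₂ * TowerRates.wide.Y j) ^ 2 = 25 / 9 * (TowerRates.wide.Y j ^ 2) := by
    rw [hR.c₂_eq]; ring
  have hYA : TowerRates.wide.Y j ^ 2 = TowerRates.wide.N j ^ (TowerRates.wide.β - 2) *
      TowerRates.wide.A j := by
    have := TowerRates.wide.Y_sq_div_A j
    rw [div_eq_iff hA.ne'] at this
    exact this
  rw [hR.c₁_eq, one_mul, hY2, hYA]
  constructor
  · intro h
    have : TowerRates.wide.A j * 1 ≤ TowerRates.wide.A j *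
        (C * (25 / 9) * TowerRates.wide.N j ^ (TowerRates.wide.β - 2)) := by nlinarith
    exact le_of_mul_le_mul_left this hA
  · intro h
    nlinarith [mul_le_mul_of_nonneg_left h hA.le]

end Summit.NavierStokesRegularity.NavierStokesRegularity.Theorems

end
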